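import Mathlib.Analysis.ODE.ExistUnique
import Mathlib.Analysis.Calculus.MeanValue
import Literature.Analysis.FluidPDE.ClassicalSolutionCalculus
import Literature.Analysis.FunctionSpaces.FlatTorusProofs
import HarnessLib

/-!
# Global flow maps of bounded Lipschitz (and of smooth lattice-periodic) velocity fields

Analysis/ODE tool file — THEOREMS ONLY (no definitions, no named facts; D-0026 net debt 0). Written
for the D-0090 `ns-claims` cell (C153 `Betts2026`, TRUE column: `Literature.Claims.NS.Betts2026.Step_FlowMap`
— «every smooth `ℤ³`-periodic classical solution on `[0,T)` has a flow map» — and the recurring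
Lagrangian vocabulary `Literature.Claims.NS.Rockwell2025.IsFlowMap T u Φ`:
`Φ₀ = id ∧ ∀ x, ∀ t ∈ [0,T), HasDerivWithinAt (Φ · x) (u t (Φ t x)) [0,T) t`).

Classical content: Hartman, *Ordinary Differential Equations*, Ch. II, Thm. 1.1 (PDF pp. 18–19): for
`f(t, y)` continuous on `R : t₀ ≤ t ≤ t₀ + a, |y − y₀| ≤ b`, uniformly Lipschitz in `y`, `|f| ≤ M` on `R`,
the problem `y' = f(t, y), y(t₀) = y₀` has a unique solution on `[t₀, t₀ + α]`, `α = min (a, b/M)` — so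
a field bounded by `M` and Lipschitz on the whole strip (`b := M a`, `α = a`) has a solution on ALL of
`[t₀, t₀ + a]` from every point [cite: Hartman2002, Ch. II Thm. 1.1 (PDF pp. 18–19)]; Majda–Bertozzi,
*Vorticity and Incompressible Flow*, §1.3 (1.13): the particle-trajectory mapping
`dX/dt (α, t) = v(X(α, t), t)`, `X(α, 0) = α` of a velocity field [cite: MajdaBertozziCUP2002, §1.3 eq. (1.13)].

* `exists_solution_Icc_of_bound_of_lipschitz` — on a closed slab `[a, b]`: if `t ↦ v t x` is continuous on `[a,b]` for every
  `x`, `‖v t x‖ ≤ L` and `v t` is `K`-Lipschitz for `t ∈ [a,b]`, then from EVERY initial point there is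
  a solution on `[a, b]` (Mathlib's `IsPicardLindelof` with the ball radius `L (b − a)` around the
  initial point itself, so that the a-priori confinement is automatic; Hartman's `b := M a`).
* `exists_flow_Ico` — on a half-open slab `[0, T)` under the same hypotheses on every `[0, T'] ⊂ [0,T)`:
  a GLOBAL flow map `Φ : ℝ → E → E`, `Φ 0 x = x`, `HasDerivWithinAt (Φ · x) (v t (Φ t x)) (Ico 0 T) t`
  (solutions on the slabs `[0, (t+T)/2]` patched by Mathlib's uniqueness theorem
  `ODE_solution_unique_of_mem_Icc_right`).
* `exists_forall_norm_le_of_isLatticePeriodic` — a field jointly smooth on `[0,T) × ℝᵈ` and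
  `ℤᵈ`-periodic in `x` is bounded on every `[0,T'] × ℝᵈ`, `T' < T` (compactness of `[0,T'] × [0,1]ᵈ`
  and `Torus.IsLatticePeriodic.eq_of_proj_eq_holds`).
* `exists_flow_Ico_of_isSmoothSpaceTimeOn_periodic` — COROLLARY: every jointly smooth, spatially
  `ℤᵈ`-periodic velocity field on `[0,T) × ℝᵈ` (e.g. the velocity of a periodic classical Navier–Stokes
  solution, `Literature.Analysis.FluidPDE.IsClassicalNSSolutionOn (Ico 0 T)`) has a global flow map on
  `[0,T)` in the above sense (Lipschitz in `x` by the mean-value inequality from the bounded, periodic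
  slice derivative `IsSmoothSpaceTimeOn.fderiv_slice`).

Mathlib/tree search: `IsPicardLindelof`, `IsPicardLindelof.exists_eq_forall_mem_Icc_hasDerivWithinAt₀`,
`ODE_solution_unique_of_mem_Icc_right`, `lipschitzWith_of_nnnorm_fderiv_le` (Mathlib);
`Literature.Analysis.FluidPDE.IsSmoothSpaceTimeOn.continuousOn` / `.fderiv_slice` (tree,
`ClassicalSolutionCalculus`, `TaoEnstrophyLocalisation`), `Torus.IsLatticePeriodic.eq_of_proj_eq_holds`,
`Torus.proj_repr`, `Torus.repr_mem_unitCube` (tree, `FlatTorus(Proofs)`). Neighbours, not duplicated: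
`GlobalExistence` (continuation on `[0, ∞)` from a-priori bounds, field needed for all `t ≥ 0`),
`LipschitzFlow` / `CompactSupportFlow` / `LipschitzTimeDependentFlow` (autonomous or globally Lipschitz
`C¹` suspension flows on all of `ℝ`), `TorusBackwardFlow` (fields on `UnitAddTorus d`, closed slab) — none
takes a field given only on a half-open slab `[0, T)` with slab-wise bounds, which is the shape the
`Literature.Claims.NS` Lagrangian binders (`Rockwell2025.IsFlowMap`) ask for; `lean search
'IsFlowMap|IsFlowMapOn'`: consumers only.

WHAT THIS IS NOT: not a claim about NS regularity or blow-up; not a claim about any author beyond the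
typed locator.
-/

open Set Filter Metric Function
open scoped NNReal Topology ContDiff

namespace Literature.Analysis.ODE

/-! ## Solutions on a closed slab from every initial point -/

section Slab

variable {E : Type*} [NormedAddCommGroup E] [NormedSpace ℝ E]

/-- A solution on `[a, b]` (derivatives within `[a, b]`) is continuous on `[a, b]`. [folklore] -/
private theorem continuousOn_Icc_of_solution_Icc {α : ℝ → E} {v : ℝ → E → E} {a b : ℝ}
    (hα : ∀ t ∈ Icc a b, HasDerivWithinAt α (v t (α t)) (Icc a b) t) :
    ContinuousOn α (Icc a b) :=
  fun t ht => (hα t ht).continuousWithinAt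

/-- A solution on `[a, b]` has, at every `t ∈ [a, b)`, the right derivative `v t (α t)` (within `[t, ∞)`).
[folklore] -/
private theorem hasDerivWithinAt_Ici_of_solution_Icc {α : ℝ → E} {v : ℝ → E → E} {a b : ℝ}
    (hα : ∀ t ∈ Icc a b, HasDerivWithinAt α (v t (α t)) (Icc a b) t) {t : ℝ} (ht : t ∈ Ico a b) :
    HasDerivWithinAt α (v t (α t)) (Ici t) t := by
  have h := hα t (Ico_subset_Icc_self ht)
  refine h.mono_of_mem_nhdsWithin ?_
  exact mem_of_superset (Icc_mem_nhdsGE ht.2) (Icc_subset_Icc ht.1 le_rfl)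

/-- **Uniqueness on the common slab** (the uniqueness assertion of Hartman's Thm. II.1.1, `b = ∞`). Two
solutions from the same initial point, one on `[a, b₁]`, one on `[a, b₂]`, of a field that is Lipschitz in
`x` for `t ∈ [a, max b₁ b₂]`, agree on `[a, min b₁ b₂]` (Mathlib `ODE_solution_unique_of_mem_Icc_right`).
[cite: Hartman2002, Ch. II Thm. 1.1 (PDF pp. 18–19), uniqueness] -/
theorem eqOn_Icc_min_of_solutions {v : ℝ → E → E} {a b₁ b₂ : ℝ} {K : ℝ≥0}
    (hlip : ∀ t ∈ Icc a (max b₁ b₂), LipschitzWith K (v t))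
    {α β : ℝ → E} (hα : ∀ t ∈ Icc a b₁, HasDerivWithinAt α (v t (α t)) (Icc a b₁) t)
    (hβ : ∀ t ∈ Icc a b₂, HasDerivWithinAt β (v t (β t)) (Icc a b₂) t) (h0 : α a = β a) :
    EqOn α β (Icc a (min b₁ b₂)) := by
  have hsub₁ : Icc a (min b₁ b₂) ⊆ Icc a b₁ := Icc_subset_Icc le_rfl (min_le_left _ _)
  have hsub₂ : Icc a (min b₁ b₂) ⊆ Icc a b₂ := Icc_subset_Icc le_rfl (min_le_right _ _)
  exact ODE_solution_unique_of_mem_Icc_right (v := v) (s := fun _ => univ) (K := K)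
    (fun t ht => (hlip t ⟨ht.1, ht.2.le.trans min_le_max⟩).lipschitzOnWith)
    ((continuousOn_Icc_of_solution_Icc hα).mono hsub₁)
    (fun t ht => hasDerivWithinAt_Ici_of_solution_Icc hα ⟨ht.1, lt_of_lt_of_le ht.2 (min_le_left _ _)⟩)
    (fun _ _ => mem_univ _)
    ((continuousOn_Icc_of_solution_Icc hβ).mono hsub₂)
    (fun t ht => hasDerivWithinAt_Ici_of_solution_Icc hβ ⟨ht.1, lt_of_lt_of_le ht.2 (min_le_right _ _)⟩)
    (fun _ _ => mem_univ _) h0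

variable [CompleteSpace E]

/-- **Global Picard–Lindelöf on a closed slab.** If `t ↦ v t x` is continuous on `[a, b]` for every `x`,
`‖v t x‖ ≤ L` and `v t` is `K`-Lipschitz for every `t ∈ [a, b]`, then from every initial point `x` there is
a solution `α` of `α' = v t α` on `[a, b]` with `α a = x` (one-sided derivatives within `[a, b]`).
This is Hartman's Thm. II.1.1 with the parallelepiped `|y − y₀| ≤ b`, `b := M a`, so that
`α = min (a, b/M) = a`: Mathlib's `IsPicardLindelof` centred at `x` with radius `L (b − a)` and `r = 0`
(the a-priori confinement to the ball is automatic). [cite: Hartman2002, Ch. II Thm. 1.1 (PDF pp. 18–19)] -/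
theorem exists_solution_Icc_of_bound_of_lipschitz {v : ℝ → E → E} {a b : ℝ} (hab : a ≤ b) {L K : ℝ≥0}
    (hcont : ∀ x, ContinuousOn (fun t => v t x) (Icc a b))
    (hbdd : ∀ t ∈ Icc a b, ∀ x, ‖v t x‖ ≤ L)
    (hlip : ∀ t ∈ Icc a b, LipschitzWith K (v t)) (x : E) :
    ∃ α : ℝ → E, α a = x ∧ ∀ t ∈ Icc a b, HasDerivWithinAt α (v t (α t)) (Icc a b) t := by
  have hPL : IsPicardLindelof v (⟨a, left_mem_Icc.2 hab⟩ : Icc a b) x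
      (L * ⟨b - a, sub_nonneg.2 hab⟩) 0 L K :=
    { lipschitzOnWith := fun t ht => (hlip t ht).lipschitzOnWith
      continuousOn := fun y _ => hcont y
      norm_le := fun t ht y _ => hbdd t ht y
      mul_max_le := by
        rw [max_eq_left (by simp only [sub_self]; exact sub_nonneg.2 hab)]
        simp only [NNReal.coe_mul, NNReal.coe_zero, sub_zero]
        exact le_rfl }
  obtain ⟨α, hα0, hα⟩ := hPL.exists_eq_forall_mem_Icc_hasDerivWithinAt₀
  exact ⟨α, hα0, hα⟩

end Slab

/-! ## The global flow map on a half-open slab `[0, T)` -/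

section Flow

variable {E : Type*} [NormedAddCommGroup E] [NormedSpace ℝ E] [CompleteSpace E]

/-- **Global flow map on `[0, T)`.** Let `v : ℝ → E → E` be, on every closed slab `[0, T'] ⊂ [0, T)`,
continuous in `t` for each `x`, bounded, and uniformly Lipschitz in `x`. Then there is `Φ : ℝ → E → E`
with `Φ 0 x = x` and `(d/dt) Φ t x = v t (Φ t x)` as a one-sided derivative within `[0, T)` at every
`t ∈ [0, T)`, for every `x` — the global flow map (exactly the shape of
`Literature.Claims.NS.Rockwell2025.IsFlowMap T v Φ`). Construction: the solution on `[0, (t + T)/2]` from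
`x`, evaluated at `t`; well defined by `eqOn_Icc_min_of_solutions`. The object produced is the
particle-trajectory mapping (1.13) of Majda–Bertozzi, `dX/dt = v(X, t)`, `X(α, 0) = α`; the existence
mechanism is Hartman's Thm. II.1.1 on each closed slab. [cite: MajdaBertozziCUP2002, §1.3 eq. (1.13)]
[cite: Hartman2002, Ch. II Thm. 1.1 (PDF pp. 18–19)] -/
theorem exists_flow_Ico {v : ℝ → E → E} {T : ℝ}
    (hcont : ∀ T', T' < T → ∀ x, ContinuousOn (fun t => v t x) (Icc 0 T'))
    (hbdd : ∀ T', T' < T → ∃ L : ℝ≥0, ∀ t ∈ Icc 0 T', ∀ x, ‖v t x‖ ≤ L)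
    (hlip : ∀ T', T' < T → ∃ K : ℝ≥0, ∀ t ∈ Icc 0 T', LipschitzWith K (v t)) :
    ∃ Φ : ℝ → E → E, (∀ x, Φ 0 x = x) ∧
      ∀ x, ∀ t ∈ Ico 0 T, HasDerivWithinAt (fun s => Φ s x) (v t (Φ t x)) (Ico 0 T) t := by
  classical
  -- solutions on the closed slabs `[0, T']`, `0 ≤ T' < T`, from every point
  have hsol : ∀ T', 0 ≤ T' → T' < T → ∀ x : E, ∃ α : ℝ → E, α 0 = x ∧
      ∀ t ∈ Icc 0 T', HasDerivWithinAt α (v t (α t)) (Icc 0 T') t := by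
    intro T' h0 hT' x
    obtain ⟨L, hL⟩ := hbdd T' hT'
    obtain ⟨K, hK⟩ := hlip T' hT'
    exact exists_solution_Icc_of_bound_of_lipschitz h0 (hcont T' hT') hL hK x
  -- a choice of solution for every `T'` (junk `fun _ => x` outside `0 ≤ T' < T`)
  let sol : ℝ → E → ℝ → E := fun T' x =>
    if h : 0 ≤ T' ∧ T' < T then Classical.choose (hsol T' h.1 h.2 x) else fun _ => x
  have sol_spec : ∀ T', 0 ≤ T' → T' < T → ∀ x, sol T' x 0 = x ∧
      ∀ t ∈ Icc 0 T', HasDerivWithinAt (sol T' x) (v t (sol T' x t)) (Icc 0 T') t := by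
    intro T' h0 hT' x
    have h : 0 ≤ T' ∧ T' < T := ⟨h0, hT'⟩
    simp only [sol, dif_pos h]
    exact Classical.choose_spec (hsol T' h.1 h.2 x)
  -- any two of them agree where both are defined
  have sol_eq : ∀ T₁ T₂, 0 ≤ T₁ → T₁ < T → 0 ≤ T₂ → T₂ < T → ∀ x, ∀ s ∈ Icc 0 (min T₁ T₂),
      sol T₁ x s = sol T₂ x s := by
    intro T₁ T₂ h1 hT1 h2 hT2 x s hs
    obtain ⟨K, hK⟩ := hlip (max T₁ T₂) (max_lt hT1 hT2)
    exact eqOn_Icc_min_of_solutions hK (sol_spec T₁ h1 hT1 x).2 (sol_spec T₂ h2 hT2 x).2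
      ((sol_spec T₁ h1 hT1 x).1.trans (sol_spec T₂ h2 hT2 x).1.symm) hs
  -- the flow map
  refine ⟨fun t x => sol ((t + T) / 2) x t, fun x => ?_, fun x t ht => ?_⟩
  · -- `Φ 0 x = x`
    by_cases hT : 0 < T
    · exact (sol_spec ((0 + T) / 2) (by linarith) (by linarith) x).1
    · have h : ¬ (0 ≤ (0 + T) / 2 ∧ (0 + T) / 2 < T) := fun h => hT (by linarith [h.1, h.2])
      simp only [sol, dif_neg h]
  · -- derivative at `t ∈ [0, T)`: compare with the solution on `[0, T₂]`, `T₂ = (t + T)/2`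
    show HasDerivWithinAt (fun s => sol ((s + T) / 2) x s) (v t (sol ((t + T) / 2) x t)) (Ico 0 T) t
    set T₂ := (t + T) / 2 with hT₂
    have ht0 : 0 ≤ t := ht.1
    have htT₂ : t < T₂ := by rw [hT₂]; linarith [ht.2]
    have hT₂0 : 0 ≤ T₂ := ht0.trans htT₂.le
    have hT₂T : T₂ < T := by rw [hT₂]; linarith [ht.2]
    obtain ⟨-, hder⟩ := sol_spec T₂ hT₂0 hT₂T x
    -- on `[0, T₂) ∩ [0, T)` the flow coincides with `sol T₂ x`
    have hagree : ∀ s ∈ Ico 0 T₂, sol ((s + T) / 2) x s = sol T₂ x s := by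
      intro s hs
      have hs' : s < T := hs.2.trans hT₂T
      refine sol_eq ((s + T) / 2) T₂ (by linarith [hs.1]) (by linarith) hT₂0 hT₂T x s
        ⟨hs.1, le_min (by linarith) hs.2.le⟩
    have hnhds : Ico 0 T₂ ∈ 𝓝[Ico 0 T] t := by
      have h1 : Iio T₂ ∈ 𝓝 t := Iio_mem_nhds htT₂
      have h2 : Ico 0 T ∩ Iio T₂ ∈ 𝓝[Ico 0 T] t := inter_mem_nhdsWithin _ h1
      exact mem_of_superset h2 fun s hs => ⟨hs.1.1, hs.2⟩
    have hmain : HasDerivWithinAt (sol T₂ x) (v t (sol T₂ x t)) (Ico 0 T) t :=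
      (hder t ⟨ht0, htT₂.le⟩).mono_of_mem_nhdsWithin (mem_of_superset hnhds Ico_subset_Icc_self)
    have heq : (fun s => sol ((s + T) / 2) x s) =ᶠ[𝓝[Ico 0 T] t] sol T₂ x :=
      mem_of_superset hnhds fun s hs => hagree s hs
    have hval : sol ((t + T) / 2) x t = sol T₂ x t := hagree t ⟨ht0, htT₂⟩
    exact hmain.congr_of_eventuallyEq heq hval

end Flow

/-! ## Smooth lattice-periodic velocity fields -/

section Periodic

open Literature.Analysis.FluidPDE Literature.Analysis.FunctionSpaces

variable {d : Type*} [Fintype d] [DecidableEq d]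
variable {F : Type*} [NormedAddCommGroup F]

omit [Fintype d] [DecidableEq d] in
/-- The closed unit cube `[0,1]ᵈ ⊂ ℝᵈ` is compact (image of the compact box under the continuous
`WithLp` identification). [folklore] -/
private theorem isCompact_euclideanClosedUnitCube :
    IsCompact {y : EuclideanSpace ℝ d | ∀ i, y i ∈ Icc (0 : ℝ) 1} := by
  have hK : IsCompact (Set.pi univ fun _ : d => Icc (0 : ℝ) 1) := isCompact_univ_pi fun _ => isCompact_Icc
  have hc : Continuous (fun f : d → ℝ => (WithLp.toLp 2 f : EuclideanSpace ℝ d)) :=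
    (EuclideanSpace.equiv d ℝ).symm.continuous
  have himage : {y : EuclideanSpace ℝ d | ∀ i, y i ∈ Icc (0 : ℝ) 1} =
      (fun f : d → ℝ => (WithLp.toLp 2 f : EuclideanSpace ℝ d)) '' Set.pi univ fun _ : d => Icc (0 : ℝ) 1 := by
    ext y
    constructor
    · intro hy
      exact ⟨WithLp.ofLp y, fun i _ => hy i, rfl⟩
    · rintro ⟨f, hf, rfl⟩ i
      exact hf i (mem_univ i)
  rw [himage]
  exact hK.image hc

/-- **A jointly continuous, spatially lattice-periodic field is bounded on compact time slabs**: if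
`w` is jointly continuous on `[0,T) × ℝᵈ` and `w t` is `ℤᵈ`-periodic for `t ∈ [0,T)`, then for every
`T' < T` there is `C` with `‖w t x‖ ≤ C` for `t ∈ [0,T']` and ALL `x` (reduce `x` to its representative in
`[0,1)ᵈ`, `Torus.IsLatticePeriodic.eq_of_proj_eq_holds`, and use compactness of `[0,T'] × [0,1]ᵈ`:
Grafakos' identification of `1`-periodic functions on `ℝⁿ` with functions on the compact torus
`Tⁿ = [0,1]ⁿ` with opposite faces identified). [cite: Grafakos2014, §3.1.1] -/
theorem exists_forall_norm_le_of_isLatticePeriodic {w : ℝ → EuclideanSpace ℝ d → F} {T T' : ℝ}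
    (hw : ContinuousOn (uncurry w) (Ico 0 T ×ˢ univ))
    (hper : ∀ t ∈ Ico 0 T, Torus.IsLatticePeriodic (w t)) (hT' : T' < T) :
    ∃ C : ℝ, ∀ t ∈ Icc 0 T', ∀ x, ‖w t x‖ ≤ C := by
  set Q : Set (EuclideanSpace ℝ d) := {y | ∀ i, y i ∈ Icc (0 : ℝ) 1} with hQ
  have hKc : IsCompact (Icc 0 T' ×ˢ Q) := isCompact_Icc.prod isCompact_euclideanClosedUnitCube
  have hsub : Icc 0 T' ×ˢ Q ⊆ Ico 0 T ×ˢ (univ : Set (EuclideanSpace ℝ d)) :=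
    prod_mono (fun t ht => ⟨ht.1, lt_of_le_of_lt ht.2 hT'⟩) (subset_univ _)
  obtain ⟨C, hC⟩ := hKc.exists_bound_of_continuousOn (hw.mono hsub)
  refine ⟨C, fun t ht x => ?_⟩
  -- reduce `x` to the fundamental domain
  set y : EuclideanSpace ℝ d := Torus.repr (Torus.proj x) with hy
  have hyQ : y ∈ Q := fun i => Ico_subset_Icc_self (Torus.repr_mem_unitCube (Torus.proj x) i)
  have htT : t ∈ Ico 0 T := ⟨ht.1, lt_of_le_of_lt ht.2 hT'⟩
  have hwxy : w t x = w t y :=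
    Torus.IsLatticePeriodic.eq_of_proj_eq_holds (hper t htT) (Torus.proj_repr (Torus.proj x)).symm
  have := hC (t, y) ⟨ht, hyQ⟩
  simpa [uncurry, hwxy] using this

/-- The derivative of a `ℤᵈ`-periodic field is `ℤᵈ`-periodic. [folklore] -/
private theorem isLatticePeriodic_fderiv [NormedSpace ℝ F] {g : EuclideanSpace ℝ d → F}
    (hg : Torus.IsLatticePeriodic g) :
    Torus.IsLatticePeriodic (fderiv ℝ g) := by
  intro j x
  rw [← fderiv_comp_add_right (EuclideanSpace.single j 1)]
  exact congrArg (fun g' => fderiv ℝ g' x) (funext (hg j))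

/-- **Global flow map of a smooth periodic velocity field.** A velocity field `u` jointly smooth on
`[0,T) × ℝᵈ` (`IsSmoothSpaceTimeOn (Ico 0 T) u`) with `ℤᵈ`-periodic slices `u t`, `t ∈ [0,T)` — e.g. the
velocity of a periodic classical Navier–Stokes/Euler solution on `[0,T)` — has a GLOBAL flow map:
`Φ 0 = id` and `(d/dt) Φ t x = u t (Φ t x)` within `[0,T)` for all `x` and all `t ∈ [0,T)` (periodic smooth
slices are bounded and Lipschitz on every `[0,T']`, by `exists_forall_norm_le_of_isLatticePeriodic` applied
to `u` and to its slice derivative, and the mean-value inequality; then `exists_flow_Ico`). The map is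
Majda–Bertozzi's particle-trajectory mapping (1.13) of the field; existence by Hartman's Thm. II.1.1 on
the closed slabs. [cite: MajdaBertozziCUP2002, §1.3 eq. (1.13)] [cite: Hartman2002, Ch. II Thm. 1.1 (PDF pp. 18–19)] -/
theorem exists_flow_Ico_of_isSmoothSpaceTimeOn_periodic
    {u : ℝ → EuclideanSpace ℝ d → EuclideanSpace ℝ d} {T : ℝ}
    (hu : IsSmoothSpaceTimeOn (Ico 0 T) u) (hper : ∀ t ∈ Ico 0 T, Torus.IsLatticePeriodic (u t)) :
    ∃ Φ : ℝ → EuclideanSpace ℝ d → EuclideanSpace ℝ d, (∀ x, Φ 0 x = x) ∧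
      ∀ x, ∀ t ∈ Ico 0 T, HasDerivWithinAt (fun s => Φ s x) (u t (Φ t x)) (Ico 0 T) t := by
  have hcontU : ContinuousOn (uncurry u) (Ico 0 T ×ˢ univ) := hu.continuousOn
  -- the slice derivative is jointly smooth and periodic
  have hD : IsSmoothSpaceTimeOn (Ico 0 T) (fun t x => fderiv ℝ (u t) x) :=
    hu.fderiv_slice (uniqueDiffOn_Ico 0 T)
  have hDper : ∀ t ∈ Ico 0 T, Torus.IsLatticePeriodic (fun x => fderiv ℝ (u t) x) :=
    fun t ht => isLatticePeriodic_fderiv (hper t ht)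
  refine exists_flow_Ico (fun T' hT' x => ?_) (fun T' hT' => ?_) (fun T' hT' => ?_)
  · -- continuity in `t` for fixed `x`
    rcases lt_or_ge T' 0 with h0 | h0
    · rw [Icc_eq_empty (by linarith)]; exact continuousOn_empty _
    · have hsub : Icc 0 T' ⊆ Ico 0 T := fun t ht => ⟨ht.1, lt_of_le_of_lt ht.2 hT'⟩
      have hc : ContinuousOn (fun t : ℝ => ((t, x) : ℝ × EuclideanSpace ℝ d)) (Icc 0 T') :=
        (continuous_id.prodMk continuous_const).continuousOn
      exact hcontU.comp hc fun t ht => mk_mem_prod (hsub ht) (mem_univ x)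
  · -- uniform bound
    obtain ⟨C, hC⟩ := exists_forall_norm_le_of_isLatticePeriodic hcontU hper hT'
    exact ⟨⟨max C 0, le_max_right _ _⟩, fun t ht x => (hC t ht x).trans (le_max_left C 0)⟩
  · -- uniform Lipschitz constant from the bounded periodic slice derivative
    obtain ⟨C, hC⟩ := exists_forall_norm_le_of_isLatticePeriodic hD.continuousOn hDper hT'
    refine ⟨⟨max C 0, le_max_right _ _⟩, fun t ht => ?_⟩
    have htT : t ∈ Ico 0 T := ⟨ht.1, lt_of_le_of_lt ht.2 hT'⟩
    have hdiff : Differentiable ℝ (u t) := (hu.contDiff_slice htT).differentiable (by simp)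
    refine lipschitzWith_of_nnnorm_fderiv_le hdiff fun x => ?_
    rw [← NNReal.coe_le_coe, coe_nnnorm]
    exact (hC t ht x).trans (le_max_left C 0)

end Periodic

end Literature.Analysis.ODE
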